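import Summits.QuantumFields.GaugeBoot.TiltedBoxTwoDimEvenSiteBlocks
import Summits.QuantumFields.GaugeBoot.TiltedBoxEvenMidAxisGeometry
import HarnessLib

/-!
# The reduced half of the site mirror of the even square tilted box in general dimension: weights and rest (gauge-boot, L3 supplement: reduced-half in-plane mirrors, 3a/7)

HONEST FRAMING (cell `pub-gaugeboot`, page 1 of every file): the venture produces certified bounds
on lattice expectations at stated coupling, gauge group, dimension and torus size; NOT a mass gap,
NOT a continuum limit, NOT a string tension; NOT Yang–Mills-summit-bearing (barriers
`FixedCouplingUltralocality`, `PerturbativeInvisibility`). This module is bookkeeping for a small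
structural NEGATIVE result (the REDUCED-half in-plane mirrors of the square tilted boxes are not of
positive type in `d ≥ 3` at small coupling); it discharges nothing by itself.

## Content (even box `ℤ^d/Γ(2P, 2P, L)`, `P ≥ 2`, site mirror `Θ_i : x_i ↦ -x_i`, any `d`)

`TiltedBoxTwoDimEvenSiteBlocks/Annulus.lean` (gen 50) treat the REDUCED half
`{0 ≤ x_i ≤ P - 1}` (`TwoDim.IsRedSiteLink`; the twisted layer `x_i ≡ P` left out) in TWO
dimensions, where every plaquette has an `i`-side. Here, for general `d`:

* the reduced-half WEIGHTS `wT` (transverse plaquette inside the layer `a`: `½` on the fixed layer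
  `0`, `1` on the layers `1 ≤ a ≤ P - 1`, `0` else) and `wL` (plaquette with an `i`-side based in
  the layer `a`: `1` iff `a ≤ P - 2`), `redW p`; the REST plaquettes `IsRest` (the slab `P-1|P`,
  the transverse plaquettes of the free layer `P`, the slab `P|P+1`) and the cancellation identity
  **`redW_add_redW_plaqReflect`**: `c_p + c_{Θp} = 0` on the rest, `= 1` elsewhere;
* `isRedSiteLink_of_redW_ne_zero` — a plaquette of non-zero weight reads only reduced-half links;
* the half-weighted action `redExpoG`, and ★ **`redExpoG_configReflect_add`**:
  `E(ΘU) + E(U) - S(U) = -∑_{rest} (N - Re tr ρ(U_q))`;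
* the witness itself (`(W_v - W_{v+T}) · e^{β E}`) follows in `TiltedBoxRedSiteWitness.lean`.

Elementary; mechanism folklore (half-space weights as in `TiltedBoxOddAxisWitness.lean`).
-/

noncomputable section

open QuotientAddGroup Finset Function MeasureTheory
open scoped ComplexConjugate

namespace Summit.QuantumFields.GaugeBoot

namespace TiltedRP

namespace RedSite

variable {d : ℕ} {i j : Fin d} {L P N : ℕ} [NeZero L] [NeZero P]
variable {G : Type*} [Group G]

/-! ## The reduced-half weights -/

variable (P) in
/-- Weight of a TRANSVERSE plaquette (no `i`-side) inside the layer `x_i ≡ a` of the even box: `½` on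
the pointwise fixed layer `a = 0`, `1` on the layers `1 ≤ a ≤ P - 1` of the reduced half, `0`
outside. [folklore] -/
def wT (a : ZMod (2 * P)) : ℝ := if a = 0 then 1 / 2 else if a.val + 1 ≤ P then 1 else 0

variable (P) in
/-- Weight of a LONGITUDINAL plaquette (with an `i`-side) based in the layer `a` (between `a` and
`a + 1`): `1` iff both layers are in the reduced half, `a ≤ P - 2`. [folklore] -/
def wL (a : ZMod (2 * P)) : ℝ := if a.val + 2 ≤ P then 1 else 0

omit [NeZero P] in
/-- `wT(a) + wT(-a) = 1` off the free layer `a = P`, `= 0` on it. [folklore] -/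
theorem wT_add_wT_neg (hP : 2 ≤ P) (a : ZMod (2 * P)) :
    wT P a + wT P (-a) = if a.val = P then 0 else 1 := by
  have ha := val_lt_two_mul hP a
  unfold wT
  by_cases h0 : a = 0
  · subst h0
    rw [neg_zero, if_pos rfl, ZMod.val_zero, if_neg (by omega)]; norm_num
  · have hn0 : -a ≠ 0 := neg_ne_zero.2 h0
    have hv0 : a.val ≠ 0 := fun h => h0 ((eq_zero_iff_val a).2 h)
    rw [if_neg h0, if_neg hn0, val_neg hP, if_neg hv0]
    by_cases h1 : a.val + 1 ≤ P
    · rw [if_pos h1, if_neg (by omega), if_neg (by omega)]; norm_num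
    · rw [if_neg h1]
      by_cases h2 : a.val = P
      · rw [if_neg (by omega), if_pos h2]; norm_num
      · rw [if_pos (by omega), if_neg h2]; norm_num

omit [NeZero P] in
/-- `wL(a) + wL(-a-1) = 1` off the two slabs around the free layer (`a ∈ {P-1, P}`), `= 0` on them.
[folklore] -/
theorem wL_add_wL_refl (hP : 2 ≤ P) (a : ZMod (2 * P)) :
    wL P a + wL P (-a - 1) = if a.val = P - 1 ∨ a.val = P then 0 else 1 := by
  have ha := val_lt_two_mul hP a
  unfold wL
  rw [TwoDim.val_neg_sub_one hP]
  by_cases h1 : a.val + 2 ≤ P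
  · rw [if_pos h1, if_neg (by omega), if_neg (by omega)]; norm_num
  · rw [if_neg h1]
    by_cases h2 : a.val = P - 1 ∨ a.val = P
    · rw [if_neg (by omega), if_pos h2]; norm_num
    · rw [if_pos (by omega), if_neg h2]; norm_num

/-- **The reduced-half weight of a plaquette** of the even box: `wL` of its base layer if it has an
`i`-side, `wT` otherwise. [folklore] -/
def redW (p : Plaq (TiltedSite d i j (2 * P) (2 * P) L) d) : ℝ :=
  if p.2.1.1 = i ∨ p.2.1.2 = i then wL P (axisCoord d L (2 * P) p.1)
  else wT P (axisCoord d L (2 * P) p.1)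

/-- **A REST plaquette** (neither in the reduced half nor in its mirror image): with an `i`-side and
based in the layer `P - 1` or `P` (the two slabs around the free layer), or transverse inside the free
layer `x_i ≡ P`. [folklore] -/
def IsRest (p : Plaq (TiltedSite d i j (2 * P) (2 * P) L) d) : Prop :=
  ((p.2.1.1 = i ∨ p.2.1.2 = i) ∧
      ((axisCoord d L (2 * P) p.1).val = P - 1 ∨ (axisCoord d L (2 * P) p.1).val = P)) ∨
    (¬ (p.2.1.1 = i ∨ p.2.1.2 = i) ∧ (axisCoord d L (2 * P) p.1).val = P)

/-- `IsRest` is decidable. [folklore] -/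
instance instDecidableIsRest (p : Plaq (TiltedSite d i j (2 * P) (2 * P) L) d) : Decidable (IsRest (P := P) p) := by
  unfold IsRest; infer_instance

variable (d i j L P) in
/-- The finite set of rest plaquettes. [folklore] -/
def restSet : Finset (Plaq (TiltedSite d i j (2 * P) (2 * P) L) d) := univ.filter fun p => IsRest (P := P) p

/-- Membership in the rest set. [folklore] -/
theorem mem_restSet {p : Plaq (TiltedSite d i j (2 * P) (2 * P) L) d} : p ∈ restSet d i j L P ↔ IsRest (P := P) p := by
  simp [restSet]

omit [NeZero L] [NeZero P] in
/-- **The cancellation identity**: `c_p + c_{Θ p} = 0` for rest plaquettes, `= 1` for all others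
(`Θ p = plaqReflect`, the site mirror along `i`). [folklore] -/
theorem redW_add_redW_plaqReflect (hP : 2 ≤ P) (hij : i ≠ j)
    (p : Plaq (TiltedSite d i j (2 * P) (2 * P) L) d) :
    redW p + redW (IsSiteFrame.plaqReflect (tiltedUnit d i j (2 * P) (2 * P) L) i
      (tiltedAxisFlip d L (2 * P) hij) p) = if IsRest (P := P) p then 0 else 1 := by
  unfold redW IsRest
  rw [IsSiteFrame.plaqReflect_snd]
  by_cases hp : p.2.1.1 = i ∨ p.2.1.2 = i
  · rw [if_pos hp, if_pos hp, IsSiteFrame.plaqReflect_fst_of_hasDir hp, map_sub, axisCoord_tiltedAxisFlip,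
      axisCoord_tiltedUnit_self, wL_add_wL_refl hP]
    by_cases ha : (axisCoord d L (2 * P) p.1).val = P - 1 ∨ (axisCoord d L (2 * P) p.1).val = P
    · rw [if_pos ha, if_pos (Or.inl ⟨hp, ha⟩)]
    · rw [if_neg ha, if_neg (by rintro (⟨-, h⟩ | ⟨h, -⟩); exacts [ha h, h hp])]
  · rw [if_neg hp, if_neg hp, IsSiteFrame.plaqReflect_fst_of_not_hasDir hp, axisCoord_tiltedAxisFlip,
      wT_add_wT_neg hP]
    by_cases ha : (axisCoord d L (2 * P) p.1).val = P
    · rw [if_pos ha, if_pos (Or.inr ⟨hp, ha⟩)]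
    · rw [if_neg ha, if_neg (by rintro (⟨h, -⟩ | ⟨-, h⟩); exacts [hp h, ha h])]

/-! ## Plaquettes of non-zero weight read only the reduced half -/

omit [NeZero L] [NeZero P] in
/-- `x_i(x + e_k) = x_i(x) + [k = i]` as natural numbers, away from the top of `ZMod (2P)`. [folklore] -/
theorem val_axisCoord_add_tiltedUnit (hP : 2 ≤ P) (x : TiltedSite d i j (2 * P) (2 * P) L) (k : Fin d)
    (hx : (axisCoord d L (2 * P) x).val + 2 ≤ 2 * P) :
    (axisCoord d L (2 * P) (x + tiltedUnit d i j (2 * P) (2 * P) L k)).val =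
      (axisCoord d L (2 * P) x).val + if k = i then 1 else 0 := by
  rw [axisCoord_add_tiltedUnit]
  by_cases hk : k = i
  · rw [if_pos hk, if_pos hk, val_add_one hP, if_neg (by omega)]
  · rw [if_neg hk, if_neg hk, add_zero, add_zero]

omit [NeZero L] [NeZero P] in
/-- **A plaquette with non-zero reduced-half weight has all four links in the reduced half**
`{0 ≤ x_i ≤ P - 1}` (both endpoints). [folklore] -/
theorem isRedSiteLink_of_redW_ne_zero (hP : 2 ≤ P) {p : Plaq (TiltedSite d i j (2 * P) (2 * P) L) d}
    (hp : redW p ≠ 0) :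
    TwoDim.IsRedSiteLink (P := P) (p.1, p.2.1.1) ∧
    TwoDim.IsRedSiteLink (P := P) (p.1 + tiltedUnit d i j (2 * P) (2 * P) L p.2.1.1, p.2.1.2) ∧
    TwoDim.IsRedSiteLink (P := P) (p.1 + tiltedUnit d i j (2 * P) (2 * P) L p.2.1.2, p.2.1.1) ∧
    TwoDim.IsRedSiteLink (P := P) (p.1, p.2.1.2) := by
  have hkl : p.2.1.1 ≠ p.2.1.2 := ne_of_lt p.2.2
  -- the base layer `a` and the budget: `a + [k = i] + [l = i] + 1 ≤ P`
  have hbudget : (axisCoord d L (2 * P) p.1).val + (if p.2.1.1 = i then 1 else 0) +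
      (if p.2.1.2 = i then 1 else 0) + 1 ≤ P := by
    unfold redW at hp
    by_cases hd : p.2.1.1 = i ∨ p.2.1.2 = i
    · rw [if_pos hd] at hp
      unfold wL at hp
      have h2 : (axisCoord d L (2 * P) p.1).val + 2 ≤ P := by by_contra h; exact hp (if_neg h)
      rcases hd with h | h
      · rw [if_pos h, if_neg (fun h' => hkl (h.trans h'.symm))]; omega
      · rw [if_neg (fun h' => hkl (h'.trans h.symm)), if_pos h]; omega
    · rw [if_neg hd] at hp
      unfold wT at hp
      rw [not_or] at hd
      rw [if_neg hd.1, if_neg hd.2]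
      have h1 : (axisCoord d L (2 * P) p.1).val + 1 ≤ P := by
        by_cases h0 : axisCoord d L (2 * P) p.1 = 0
        · rw [h0, ZMod.val_zero]; omega
        · rw [if_neg h0] at hp
          by_contra h; exact hp (if_neg h)
      omega
  -- values of the four vertices
  have hv1 : (axisCoord d L (2 * P) (p.1 + tiltedUnit d i j (2 * P) (2 * P) L p.2.1.1)).val =
      (axisCoord d L (2 * P) p.1).val + if p.2.1.1 = i then 1 else 0 :=
    val_axisCoord_add_tiltedUnit hP p.1 p.2.1.1 (by split_ifs at hbudget <;> omega)
  have hv2 : (axisCoord d L (2 * P) (p.1 + tiltedUnit d i j (2 * P) (2 * P) L p.2.1.2)).val =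
      (axisCoord d L (2 * P) p.1).val + if p.2.1.2 = i then 1 else 0 :=
    val_axisCoord_add_tiltedUnit hP p.1 p.2.1.2 (by split_ifs at hbudget <;> omega)
  have hv12 : (axisCoord d L (2 * P) (p.1 + tiltedUnit d i j (2 * P) (2 * P) L p.2.1.1 +
      tiltedUnit d i j (2 * P) (2 * P) L p.2.1.2)).val =
      (axisCoord d L (2 * P) p.1).val + (if p.2.1.1 = i then 1 else 0) + if p.2.1.2 = i then 1 else 0 := by
    rw [val_axisCoord_add_tiltedUnit hP _ p.2.1.2 (by rw [hv1]; split_ifs at hbudget ⊢ <;> omega), hv1]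
  have hv21 : (axisCoord d L (2 * P) (p.1 + tiltedUnit d i j (2 * P) (2 * P) L p.2.1.2 +
      tiltedUnit d i j (2 * P) (2 * P) L p.2.1.1)).val =
      (axisCoord d L (2 * P) p.1).val + (if p.2.1.1 = i then 1 else 0) + if p.2.1.2 = i then 1 else 0 := by
    rw [add_right_comm]; exact hv12
  unfold TwoDim.IsRedSiteLink
  dsimp only
  refine ⟨⟨?_, ?_⟩, ⟨?_, ?_⟩, ⟨?_, ?_⟩, ⟨?_, ?_⟩⟩
  · split_ifs at hbudget <;> omega
  · rw [hv1]; split_ifs at hbudget ⊢ <;> omega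
  · rw [hv1]; split_ifs at hbudget ⊢ <;> omega
  · rw [hv12]; split_ifs at hbudget ⊢ <;> omega
  · rw [hv2]; split_ifs at hbudget ⊢ <;> omega
  · rw [hv21]; split_ifs at hbudget ⊢ <;> omega
  · split_ifs at hbudget <;> omega
  · rw [hv2]; split_ifs at hbudget ⊢ <;> omega

variable (ρ : G →* Matrix (Fin N) (Fin N) ℂ)

omit [NeZero L] [NeZero P] in
/-- Plaquette observables agree on configurations agreeing on the reduced-half links, for plaquettes
of non-zero weight. [folklore] -/
theorem plaqObs_eq_of_redW_ne_zero [NeZero L] [NeZero P] (hP : 2 ≤ P)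
    {U V : Config (TiltedSite d i j (2 * P) (2 * P) L) d G}
    (hUV : ∀ l, TwoDim.IsRedSiteLink (P := P) l → U l = V l)
    {p : Plaq (TiltedSite d i j (2 * P) (2 * P) L) d} (hp : redW p ≠ 0) :
    plaqObs ρ (tiltedUnit d i j (2 * P) (2 * P) L) p U = plaqObs ρ (tiltedUnit d i j (2 * P) (2 * P) L) p V := by
  obtain ⟨h1, h2, h3, h4⟩ := isRedSiteLink_of_redW_ne_zero hP hp
  unfold plaqObs
  rw [holonomy_congr _ p.1 p.2.1.1 p.2.1.2 (hUV _ h1) (hUV _ h2) (hUV _ h3) (hUV _ h4)]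

/-! ## The half-weighted action and the cancellation of the Boltzmann weight -/

/-- The half-weighted action `E(U) = ∑_p c_p (N - Re tr ρ(U_p))` of the reduced half (general `d`).
[folklore] -/
def redExpoG (U : Config (TiltedSite d i j (2 * P) (2 * P) L) d G) : ℝ :=
  ∑ p : Plaq (TiltedSite d i j (2 * P) (2 * P) L) d,
    redW p * ((N : ℝ) - plaqObs ρ (tiltedUnit d i j (2 * P) (2 * P) L) p U)

/-- `E` is continuous. [folklore] -/
theorem continuous_redExpoG [TopologicalSpace G] [IsTopologicalGroup G] (hρ : Continuous ρ) :
    Continuous fun U : Config (TiltedSite d i j (2 * P) (2 * P) L) d G => redExpoG ρ U :=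
  continuous_finsetSum _ fun p _ => continuous_const.mul (continuous_const.sub (continuous_plaqObs ρ hρ _ p))

/-- `E` reads only the reduced half. [folklore] -/
theorem redExpoG_eq_of_redSiteLinks (hP : 2 ≤ P) {U V : Config (TiltedSite d i j (2 * P) (2 * P) L) d G}
    (hUV : ∀ l, TwoDim.IsRedSiteLink (P := P) l → U l = V l) : redExpoG ρ U = redExpoG ρ V := by
  unfold redExpoG
  refine Finset.sum_congr rfl fun p _ => ?_
  by_cases hp : redW p = 0
  · rw [hp, zero_mul, zero_mul]
  · rw [plaqObs_eq_of_redW_ne_zero ρ hP hUV hp]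

/-- ★ **`E(ΘU) + E(U) - S(U) = -∑_{rest} (N - Re tr ρ(U_q))`.** [folklore] -/
theorem redExpoG_configReflect_add [TopologicalSpace G] [IsTopologicalGroup G] [CompactSpace G]
    (hP : 2 ≤ P) (hij : i ≠ j) (hρ : Continuous ρ) (U : Config (TiltedSite d i j (2 * P) (2 * P) L) d G) :
    redExpoG ρ (configReflect (tiltedUnit d i j (2 * P) (2 * P) L) i (tiltedAxisFlip d L (2 * P) hij) U) +
      redExpoG ρ U - wilsonAction ρ (tiltedUnit d i j (2 * P) (2 * P) L) U =
      -∑ p ∈ restSet d i j L P, ((N : ℝ) - plaqObs ρ (tiltedUnit d i j (2 * P) (2 * P) L) p U) := by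
  have hF : IsAxisFlip (tiltedUnit d i j (2 * P) (2 * P) L) i (tiltedAxisFlip d L (2 * P) hij) :=
    isAxisFlip_tiltedAxisFlip d L (2 * P) hij
  have h1 : redExpoG ρ (configReflect (tiltedUnit d i j (2 * P) (2 * P) L) i (tiltedAxisFlip d L (2 * P) hij) U) =
      ∑ p : Plaq (TiltedSite d i j (2 * P) (2 * P) L) d,
        redW (IsSiteFrame.plaqReflect (tiltedUnit d i j (2 * P) (2 * P) L) i (tiltedAxisFlip d L (2 * P) hij) p) *
          ((N : ℝ) - plaqObs ρ (tiltedUnit d i j (2 * P) (2 * P) L) p U) := by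
    unfold redExpoG
    simp_rw [hF.plaqObs_configReflect ρ hρ]
    exact Fintype.sum_equiv (Function.Involutive.toPerm _ hF.plaqReflect_plaqReflect) _ _
      fun p => by simp [hF.plaqReflect_plaqReflect p]
  rw [h1, redExpoG, wilsonAction, ← Finset.sum_add_distrib, ← Finset.sum_sub_distrib, ← Finset.sum_neg_distrib,
    restSet, Finset.sum_filter]
  refine Finset.sum_congr rfl fun p _ => ?_
  have h2 := redW_add_redW_plaqReflect hP hij p
  rw [add_comm] at h2
  by_cases hs : IsRest (P := P) p
  · rw [if_pos hs] at h2; rw [if_pos hs]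
    linear_combination ((N : ℝ) - plaqObs ρ (tiltedUnit d i j (2 * P) (2 * P) L) p U) * h2
  · rw [if_neg hs] at h2; rw [if_neg hs]
    linear_combination ((N : ℝ) - plaqObs ρ (tiltedUnit d i j (2 * P) (2 * P) L) p U) * h2

end RedSite

end TiltedRP

end Summit.QuantumFields.GaugeBoot

end
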